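import Mathlib
import HarnessLib
import Summits.NavierStokesRegularity.NavierStokesRegularity.Theorems.PoloidalWindowDoorPoloidalWindowRigidityOneSlice
import Summits.NavierStokesRegularity.NavierStokesRegularity.Theorems.PoloidalWindowDoorPoloidalWindowRigidityPeriodic
import Literature.Analysis.FluidPDE.VorticityCalculus
import Summits.NavierStokesRegularity.NavierStokesRegularity.Theorems.PoloidalWindowDoorPoloidalWindowRigidityStrata

/-!
# Door S11 `LocalTubeDoorHelicity` (nsreg-p1 ROUND-11/13), profile crux K2⁗ `FrobeniusProfileRigidity` —
# ONE SLICE DETERMINES THE PROFILE; spatially periodic ONE slice ⇒ trivial; helically symmetric ONE slice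
# (screw invariance, pitch `≠ 0`, swirl allowed) ⇒ trivial; `(−1)`-homogeneous ONE slice ⇒ trivial

Cell ns-regularity-ideate, seat p5 (route-directed support for the door route `route-helicity` staged by p1 g11;
lands `--supports` the K2⁗ item; no claim on the crux).  Companion of
`…LocalHelicityTubeDoorFrobeniusProfileRigidityScrewSlice` (screw VORTICITY on a window of one slice): here the screw
stratum on the SYMMETRY side, in the ONE-SLICE form in which the line of record (the slice quadrichotomy of the
birth skeleton `bc/FrobeniusProfileRigidity_birth.lean`) states its alternatives.  The base points of nsreg-p1's
ROUND-13 Cartan census are HELICAL jets; this file records that in the Type-I profile class the helical stratum with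
nonzero pitch is EMPTY, with or without helical swirl:

* `eq_of_slice_eq` — **one slice determines the profile**: two fields of the Oseen-ancient class 𝔄 (continuous on
  the open slab, bounded on sub-slabs, unit-viscosity Oseen-mild identity) which agree on ONE slice `s < 0` agree on
  every slice `t < 0` — forward by bounded Oseen-mild uniqueness (tree `oseenMild_bounded_unique`, KNSS 2009 §4:
  same free term `e^{(t−s)Δ} v(s)`), backward by real-analyticity in time (tree `analyticOnNhd_uncurry`) and the
  identity theorem on the connected `(−∞,0)` (the scheme of the tree's `conj_eq_forward/backward`, stated once for
  two arbitrary members);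
* `translate_eq_of_periodic_slice` — a spatial period `ℓ` of ONE slice is a period of EVERY slice (the translate
  `(t,y) ↦ v(t, y + ℓ)` is in the class, tree `class_translate`, and agrees with `v` on the slice `s`);
* `eq_zero_of_periodic_slice` / `nonflatLiouville_of_periodic_slice` — **a profile of the Type-I class with ONE
  spatially periodic slice (period `ℓ ≠ 0`) vanishes identically** (then every slice is periodic and the tree's
  zoom-out theorem `eq_zero_of_spatiallyPeriodic`, seat K2-p2 (M9), applies — it assumed periodicity of all slices);
* `eq_zero_of_helical_slice` / `eq_zero_of_helical_slice_anyAxis` /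
  `nonflatLiouville_of_helical_slice_anyAxis` — **ONE helically symmetric slice ⇒ trivial**: if one slice is
  equivariant under the screw motions `y ↦ R_θ y + hθ e₂` (about the `x₂`-axis, or about any axis after a rigid
  motion `y ↦ L y + c`), pitch `h ≠ 0`, then `θ = 2π` exhibits the spatial period `2πh e₂` of that slice.  Helical
  swirl is allowed.  Pitch `h = 0` is axisymmetry WITH swirl — KNSS's open case, not touched here;
* `eq_zero_of_discreteScrew_slice` (appended) — ONE slice equivariant under a rigid motion `y ↦ L y + ℓ` with
  `L^[n] = id`, `L ℓ = ℓ ≠ 0` (rational-angle discrete screw, glide reflection) ⇒ `v ≡ 0` (the `n`-th iterate is the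
  translation by `n ℓ`);
* `eq_zero_of_homogeneous_negOne` / `eq_zero_of_homogeneous_slice` — the DILATION conjugacy class is trivially
  empty: a continuous field which is `(−1)`-homogeneous about a centre vanishes, so no slice of a profile of the class
  is a Landau / Šverák-type homogeneous field (the germ-level refuters of local Frobenius rigidity, LIT-PACK §R47).

SUPPORT EDGE (route-NavierStokesRegularity-LocalHelicityTubeDoor born; director-ns g6 #1 (5)): this file is re-pointed
`--supports stmt-NavierStokesRegularity-19975 --as helper` (nsreg-p5 g7 p472225/p473214: helical / periodic / homogeneous / discrete-screw one-slice strata); it was parked on the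
CLOSED fallback anchor stmt-NavierStokesRegularity-20018 while the route was unborn.  Declarations unchanged.

WHAT THIS IS NOT: not a claim about Navier–Stokes regularity and not K2⁗ (whose load-bearing stub stays OPEN) —
settled symmetry strata of a door route's profile crux (bears_on LADDER-NS N0, door S11).
-/

noncomputable section

-- the summit and its single sub-problem share the name (CONVENTIONS §1), as in every Theorems file
set_option linter.dupNamespace false

namespace Summit.NavierStokesRegularity.NavierStokesRegularity.Theorems.LocalHelicityTubeDoorFrobeniusProfileRigidityHelicalSlice

open MeasureTheory Set Function Filter Topology TopologicalSpace Metric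
open scoped RealInnerProductSpace InnerProductSpace
open Literature.Analysis Literature.Analysis.FluidPDE
open Summit.NavierStokesRegularity.NavierStokesRegularity.Theorems.LocalSineTubeDoorProfileAlignedWindowRigidityAncient
open Summit.NavierStokesRegularity.NavierStokesRegularity.Theorems.PoloidalWindowDoorPoloidalWindowRigidityFlat
open Summit.NavierStokesRegularity.NavierStokesRegularity.Theorems.PoloidalWindowDoorPoloidalWindowRigidityAxisymmetric
open Summit.NavierStokesRegularity.NavierStokesRegularity.Theorems.PoloidalWindowDoorPoloidalWindowRigidityRotate
open Summit.NavierStokesRegularity.NavierStokesRegularity.Theorems.PoloidalWindowDoorPoloidalWindowRigidityPeriodic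
open Summit.NavierStokesRegularity.NavierStokesRegularity.Theorems.PoloidalWindowDoorPoloidalWindowRigidityStrata

variable {C : ℝ} {u v : ℝ → EuclideanSpace ℝ (Fin 3) → EuclideanSpace ℝ (Fin 3)}

/-! ### One slice determines the profile (Oseen-ancient class) -/

/-- **Forward uniqueness from one slice.** Two Oseen-ancient fields `u`, `v` with `u s = v s` agree at every later
time `s ≤ t < 0`: on `(s, t/2)` both are bounded, jointly measurable, and solve the Oseen integral equation with the
SAME free term `e^{(τ−s)Δ} v(s)`; bounded-mild uniqueness (`oseenMild_bounded_unique`) gives a.e. equality of the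
slices, and continuity upgrades it to equality. -/
theorem eq_forward_of_slice_eq
    (hucont : ContinuousOn (uncurry u) (Iio (0 : ℝ) ×ˢ univ))
    (hubdd : ∀ δ : ℝ, 0 < δ → ∃ B : ℝ, ∀ t < -δ, ∀ y : EuclideanSpace ℝ (Fin 3), ‖u t y‖ ≤ B)
    (humild : ∀ s t : ℝ, s < t → t < 0 → ∀ y,
      u t y = UnboundedOperators.heatExtension (u s) (t - s) y - oseenDuhamel 1 s u u t y)
    (hvcont : ContinuousOn (uncurry v) (Iio (0 : ℝ) ×ˢ univ))
    (hvbdd : ∀ δ : ℝ, 0 < δ → ∃ B : ℝ, ∀ t < -δ, ∀ y : EuclideanSpace ℝ (Fin 3), ‖v t y‖ ≤ B)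
    (hvmild : ∀ s t : ℝ, s < t → t < 0 → ∀ y,
      v t y = UnboundedOperators.heatExtension (v s) (t - s) y - oseenDuhamel 1 s v v t y)
    {s : ℝ} (h : u s = v s) : ∀ t, s ≤ t → t < 0 → u t = v t := by
  intro t hst ht0
  rcases hst.eq_or_lt with rfl | hst'
  · exact h
  obtain ⟨T₂, htT₂, hT₂0⟩ : ∃ T₂ : ℝ, t < T₂ ∧ T₂ < 0 := ⟨t / 2, by linarith, by linarith⟩
  obtain ⟨Bu, hBu⟩ := hubdd (-T₂) (by linarith)
  obtain ⟨Bv, hBv⟩ := hvbdd (-T₂) (by linarith)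
  set M : ℝ := max (max Bu Bv) 0 with hM
  have huM : ∀ τ ∈ Ioo s T₂, ∀ y, ‖u τ y‖ ≤ M := fun τ hτ y =>
    (hBu τ (by linarith [hτ.2]) y).trans ((le_max_left _ _).trans (le_max_left _ _))
  have hvM : ∀ τ ∈ Ioo s T₂, ∀ y, ‖v τ y‖ ≤ M := fun τ hτ y =>
    (hBv τ (by linarith [hτ.2]) y).trans ((le_max_right _ _).trans (le_max_left _ _))
  have hsub : Ioo s T₂ ×ˢ (univ : Set (EuclideanSpace ℝ (Fin 3))) ⊆ Iio 0 ×ˢ univ :=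
    prod_mono (fun τ hτ => hτ.2.trans hT₂0) Subset.rfl
  have hum : AEStronglyMeasurable (uncurry u) (volume.restrict (Ioo s T₂ ×ˢ univ)) :=
    (hucont.mono hsub).aestronglyMeasurable (measurableSet_Ioo.prod MeasurableSet.univ)
  have hvm : AEStronglyMeasurable (uncurry v) (volume.restrict (Ioo s T₂ ×ˢ univ)) :=
    (hvcont.mono hsub).aestronglyMeasurable (measurableSet_Ioo.prod MeasurableSet.univ)
  have hu : ∀ τ ∈ Ioo s T₂, u τ =ᵐ[volume] fun x =>
      UnboundedOperators.heatExtension (v s) (τ - s) x - oseenDuhamel 1 s u u τ x := by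
    intro τ hτ
    refine Eventually.of_forall fun x => ?_
    rw [← h]
    exact humild s τ hτ.1 (hτ.2.trans hT₂0) x
  have hv : ∀ τ ∈ Ioo s T₂, v τ =ᵐ[volume] fun x =>
      UnboundedOperators.heatExtension (v s) (τ - s) x - oseenDuhamel 1 s v v τ x :=
    fun τ hτ => Eventually.of_forall fun x => hvmild s τ hτ.1 (hτ.2.trans hT₂0) x
  have hae := oseenMild_bounded_unique
    (U := fun τ x => UnboundedOperators.heatExtension (v s) (τ - s) x)
    one_pos (le_max_right _ 0) hum hvm huM hvM hu hv
  have ht : t ∈ Ioo s T₂ := ⟨hst', htT₂⟩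
  exact ((continuous_slice hucont ht0).ae_eq_iff_eq volume (continuous_slice hvcont ht0)).1 (hae t ht)

/-- **ONE SLICE DETERMINES THE PROFILE.** Two Oseen-ancient fields which agree on one slice `s < 0` agree on every
slice `t < 0`: forward by `eq_forward_of_slice_eq`, backward because `τ ↦ u τ y − v τ y` is real-analytic on
`(−∞,0)` (`analyticOnNhd_uncurry`) and vanishes on `[s, 0)`, hence everywhere (identity theorem on the preconnected
`(−∞,0)` — Masuda's move in place of backward uniqueness). -/
theorem eq_of_slice_eq
    (hucont : ContinuousOn (uncurry u) (Iio (0 : ℝ) ×ˢ univ))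
    (hubdd : ∀ δ : ℝ, 0 < δ → ∃ B : ℝ, ∀ t < -δ, ∀ y : EuclideanSpace ℝ (Fin 3), ‖u t y‖ ≤ B)
    (humild : ∀ s t : ℝ, s < t → t < 0 → ∀ y,
      u t y = UnboundedOperators.heatExtension (u s) (t - s) y - oseenDuhamel 1 s u u t y)
    (hvcont : ContinuousOn (uncurry v) (Iio (0 : ℝ) ×ˢ univ))
    (hvbdd : ∀ δ : ℝ, 0 < δ → ∃ B : ℝ, ∀ t < -δ, ∀ y : EuclideanSpace ℝ (Fin 3), ‖v t y‖ ≤ B)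
    (hvmild : ∀ s t : ℝ, s < t → t < 0 → ∀ y,
      v t y = UnboundedOperators.heatExtension (v s) (t - s) y - oseenDuhamel 1 s v v t y)
    {s : ℝ} (hs : s < 0) (h : u s = v s) : ∀ t < 0, u t = v t := by
  have hfwd := eq_forward_of_slice_eq hucont hubdd humild hvcont hvbdd hvmild h
  intro t ht
  funext y
  have hg : AnalyticOnNhd ℝ (fun τ => u τ y - v τ y) (Iio 0) := by
    intro τ hτ
    have h1 : AnalyticAt ℝ (uncurry u) (τ, y) :=
      analyticOnNhd_uncurry hucont hubdd humild _ (mem_prod.2 ⟨hτ, mem_univ _⟩)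
    have h2 : AnalyticAt ℝ (uncurry v) (τ, y) :=
      analyticOnNhd_uncurry hvcont hvbdd hvmild _ (mem_prod.2 ⟨hτ, mem_univ _⟩)
    have hι : AnalyticAt ℝ (fun σ : ℝ => (σ, y)) τ := analyticAt_id.prod analyticAt_const
    exact (h1.comp_of_eq hι rfl).sub (h2.comp_of_eq hι rfl)
  have hs2 : s / 2 ∈ Iio (0 : ℝ) := by
    simp only [mem_Iio]
    linarith
  have hev : (fun τ => u τ y - v τ y) =ᶠ[𝓝 (s / 2)] 0 := by
    filter_upwards [isOpen_Ioo.mem_nhds (show s / 2 ∈ Ioo s 0 from ⟨by linarith, by linarith⟩)]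
      with τ hτ
    simp only [Pi.zero_apply, sub_eq_zero]
    exact congrFun (hfwd τ hτ.1.le hτ.2) y
  have := hg.eqOn_zero_of_preconnected_of_eventuallyEq_zero isPreconnected_Iio hs2 hev ht
  simpa [sub_eq_zero] using this

/-! ### Spatially periodic ONE slice -/

/-- **A spatial period of ONE slice is a period of EVERY slice** of a profile of the Type-I class: the translate
`(t, y) ↦ v(t, y + ℓ)` is again in the class (`class_translate`) and agrees with `v` on the slice `s`, so
`eq_of_slice_eq` applies. -/
theorem translate_eq_of_periodic_slice (hrate : HasTypeITimeDecay C v)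
    (hcont : ContinuousOn (uncurry v) (Iio (0 : ℝ) ×ˢ univ))
    (hmild : ∀ s t : ℝ, s < t → t < 0 → ∀ x,
      v t x = UnboundedOperators.heatExtension (v s) (t - s) x - oseenDuhamel 1 s v v t x)
    (hdiv : ∀ t < 0, VectorCalculus.IsDivFree (v t)) {s : ℝ} (hs : s < 0)
    {ℓ : EuclideanSpace ℝ (Fin 3)} (hper : ∀ y, v s (y + ℓ) = v s y) :
    ∀ t < 0, ∀ y, v t (y + ℓ) = v t y := by
  obtain ⟨hrate₁, hcont₁, hmild₁, -⟩ := class_translate ℓ hrate hcont hmild hdiv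
  have heq := eq_of_slice_eq hcont₁ (bdd_of_hasTypeITimeDecay hrate₁) hmild₁ hcont
    (bdd_of_hasTypeITimeDecay hrate) hmild hs (funext hper)
  intro t ht y
  exact congrFun (heq t ht) y

/-- **ONE spatially periodic slice ⇒ trivial.** A profile of the Type-I class one of whose slices `s < 0` has a
spatial period `ℓ ≠ 0` vanishes identically: every slice is `ℓ`-periodic (`translate_eq_of_periodic_slice`), and the
tree's zoom-out theorem `eq_zero_of_spatiallyPeriodic` (K2-p2, M9: zoom-outs at bad points shrink the period to zero,
the KNSS limit is translation-invariant along a line, (N₁) ⇒ backward ε-regularity) concludes. -/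
theorem eq_zero_of_periodic_slice (hrate : HasTypeITimeDecay C v)
    (hcont : ContinuousOn (uncurry v) (Iio (0 : ℝ) ×ˢ univ))
    (hmild : ∀ s t : ℝ, s < t → t < 0 → ∀ x,
      v t x = UnboundedOperators.heatExtension (v s) (t - s) x - oseenDuhamel 1 s v v t x)
    (hdiv : ∀ t < 0, VectorCalculus.IsDivFree (v t)) {s : ℝ} (hs : s < 0)
    {ℓ : EuclideanSpace ℝ (Fin 3)} (hℓ : ℓ ≠ 0) (hper : ∀ y, v s (y + ℓ) = v s y) :
    ∀ t < 0, ∀ x, v t x = 0 :=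
  eq_zero_of_spatiallyPeriodic hrate hcont hmild hdiv hℓ
    (fun t ht y => translate_eq_of_periodic_slice hrate hcont hmild hdiv hs hper t ht y)

/-- ONE spatially periodic slice ⇒ not backward-singular at the apex. -/
theorem nonflatLiouville_of_periodic_slice (hrate : HasTypeITimeDecay C v)
    (hcont : ContinuousOn (uncurry v) (Iio (0 : ℝ) ×ˢ univ))
    (hmild : ∀ s t : ℝ, s < t → t < 0 → ∀ x,
      v t x = UnboundedOperators.heatExtension (v s) (t - s) x - oseenDuhamel 1 s v v t x)
    (hdiv : ∀ t < 0, VectorCalculus.IsDivFree (v t)) {s : ℝ} (hs : s < 0)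
    {ℓ : EuclideanSpace ℝ (Fin 3)} (hℓ : ℓ ≠ 0) (hper : ∀ y, v s (y + ℓ) = v s y) :
    ¬ IsBackwardSingularPoint v 0 :=
  not_backwardSingular_of_zero (eq_zero_of_periodic_slice hrate hcont hmild hdiv hs hℓ hper)

/-! ### Helically symmetric ONE slice (pitch `≠ 0`, swirl allowed) -/

/-- `2πh e₂ ≠ 0` for `h ≠ 0`. -/
theorem two_pi_mul_smul_eZ_ne_zero {h : ℝ} (hh : h ≠ 0) :
    ((h * (2 * Real.pi)) • eZ : EuclideanSpace ℝ (Fin 3)) ≠ 0 := by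
  refine smul_ne_zero (mul_ne_zero hh (by positivity)) ?_
  intro h0
  have := congrArg (fun w : EuclideanSpace ℝ (Fin 3) => w 2) h0
  simp [eZ] at this

/-- **ONE helically symmetric slice ⇒ trivial (axis `= x₂`-axis, pitch `h ≠ 0`).** If one slice `s < 0` of a
profile of the Type-I class is equivariant under the screw motions about the `x₂`-axis with pitch `h ≠ 0`,
`v(s, R_θ y + hθ e₂) = R_θ v(s, y)` for all `θ`, then `v ≡ 0`: `θ = 2π` shows that the slice is
`2πh e₂`-periodic (`R_{2π} = id`), and `eq_zero_of_periodic_slice` applies.  Helical swirl is allowed. -/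
theorem eq_zero_of_helical_slice (hrate : HasTypeITimeDecay C v)
    (hcont : ContinuousOn (uncurry v) (Iio (0 : ℝ) ×ˢ univ))
    (hmild : ∀ s t : ℝ, s < t → t < 0 → ∀ x,
      v t x = UnboundedOperators.heatExtension (v s) (t - s) x - oseenDuhamel 1 s v v t x)
    (hdiv : ∀ t < 0, VectorCalculus.IsDivFree (v t)) {s : ℝ} (hs : s < 0) {h : ℝ} (hh : h ≠ 0)
    (hhel : ∀ (θ : ℝ) (y : EuclideanSpace ℝ (Fin 3)), v s (rotZ θ y + (h * θ) • eZ) = rotZ θ (v s y)) :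
    ∀ t < 0, ∀ x, v t x = 0 := by
  -- `R_{2π} = id` (also in the tree as `…Theorems.aeToExact_rotZ_two_pi`, in a module outside this import cone)
  have h2π : ∀ z : EuclideanSpace ℝ (Fin 3), rotZ (2 * Real.pi) z = z := fun z => by
    ext i
    fin_cases i <;> simp [Real.cos_two_pi, Real.sin_two_pi]
  refine eq_zero_of_periodic_slice hrate hcont hmild hdiv hs (two_pi_mul_smul_eZ_ne_zero hh) fun y => ?_
  have := hhel (2 * Real.pi) y
  rwa [h2π, h2π] at this

/-- **… about ANY axis**: if for some linear isometry `L` and centre `c` the transported slice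
`y ↦ L⁻¹ v(s, L y + c)` is helically symmetric about the `x₂`-axis with pitch `h ≠ 0`, then `v ≡ 0` (the class is
invariant under translations and linear isometries: `class_translate`, `class_conj_linearIsometryEquiv`). -/
theorem eq_zero_of_helical_slice_anyAxis (hrate : HasTypeITimeDecay C v)
    (hcont : ContinuousOn (uncurry v) (Iio (0 : ℝ) ×ˢ univ))
    (hmild : ∀ s t : ℝ, s < t → t < 0 → ∀ x,
      v t x = UnboundedOperators.heatExtension (v s) (t - s) x - oseenDuhamel 1 s v v t x)
    (hdiv : ∀ t < 0, VectorCalculus.IsDivFree (v t))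
    (L : EuclideanSpace ℝ (Fin 3) ≃ₗᵢ[ℝ] EuclideanSpace ℝ (Fin 3)) (c : EuclideanSpace ℝ (Fin 3))
    {s : ℝ} (hs : s < 0) {h : ℝ} (hh : h ≠ 0)
    (hhel : ∀ (θ : ℝ) (y : EuclideanSpace ℝ (Fin 3)),
      L.symm (v s (L (rotZ θ y + (h * θ) • eZ) + c)) = rotZ θ (L.symm (v s (L y + c)))) :
    ∀ t < 0, ∀ x, v t x = 0 := by
  -- the transported profile `w t y = L⁻¹ v(t, L y + c)` is in the class
  obtain ⟨hrate₁, hcont₁, hmild₁, hdiv₁⟩ := class_translate c hrate hcont hmild hdiv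
  obtain ⟨hrate₂, hcont₂, hmild₂, hdiv₂⟩ := class_conj_linearIsometryEquiv L.symm hrate₁ hcont₁ hmild₁ hdiv₁
  simp only [LinearIsometryEquiv.symm_symm] at hrate₂ hcont₂ hmild₂ hdiv₂
  have hw := eq_zero_of_helical_slice hrate₂ hcont₂ hmild₂ hdiv₂ hs hh hhel
  intro t ht x
  have h1 := hw t ht (L.symm (x - c))
  have h2 : L (L.symm (x - c)) + c = x := by simp
  simp only [h2] at h1
  simpa using congrArg L h1

/-- ONE helically symmetric slice (pitch `≠ 0`, any axis, swirl allowed) ⇒ not backward-singular at the apex. -/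
theorem nonflatLiouville_of_helical_slice_anyAxis (hrate : HasTypeITimeDecay C v)
    (hcont : ContinuousOn (uncurry v) (Iio (0 : ℝ) ×ˢ univ))
    (hmild : ∀ s t : ℝ, s < t → t < 0 → ∀ x,
      v t x = UnboundedOperators.heatExtension (v s) (t - s) x - oseenDuhamel 1 s v v t x)
    (hdiv : ∀ t < 0, VectorCalculus.IsDivFree (v t))
    (L : EuclideanSpace ℝ (Fin 3) ≃ₗᵢ[ℝ] EuclideanSpace ℝ (Fin 3)) (c : EuclideanSpace ℝ (Fin 3))
    {s : ℝ} (hs : s < 0) {h : ℝ} (hh : h ≠ 0)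
    (hhel : ∀ (θ : ℝ) (y : EuclideanSpace ℝ (Fin 3)),
      L.symm (v s (L (rotZ θ y + (h * θ) • eZ) + c)) = rotZ θ (L.symm (v s (L y + c)))) :
    ¬ IsBackwardSingularPoint v 0 :=
  not_backwardSingular_of_zero (eq_zero_of_helical_slice_anyAxis hrate hcont hmild hdiv L c hs hh hhel)

/-! ### Homogeneous ONE slice (dilation invariance about a centre) — trivially empty

The remaining conjugacy type of one-parameter subgroups of `Sim(ℝ³)` besides translations, rotations and screws is
the DILATIONS (and spiral similarities).  Šverák's (−1)-homogeneous steady solutions (Landau and the conformal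
complex-lamellar family, LIT-PACK §R47) are helicity-free and refute every LOCAL (germ-level) rigidity statement for
the Frobenius class; but a slice of a profile of the Type-I class is CONTINUOUS on `ℝ³`, so it cannot be
(−1)-homogeneous about any centre unless it vanishes — recorded here so that the line of record need not carry this
alternative. -/

/-- **A continuous field which is `(−1)`-homogeneous about a centre `c` — `V(c + λ w) = λ⁻¹ V(c + w)` for all `λ > 0`
and all `w` — vanishes identically**: along `λ → 0⁺` the left side stays bounded (continuity at `c`), the right side
does not, unless `V(c + w) = 0`. -/
theorem eq_zero_of_homogeneous_negOne {V : EuclideanSpace ℝ (Fin 3) → EuclideanSpace ℝ (Fin 3)} (hV : Continuous V)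
    (c : EuclideanSpace ℝ (Fin 3))
    (hhom : ∀ (lam : ℝ), 0 < lam → ∀ w : EuclideanSpace ℝ (Fin 3), V (c + lam • w) = lam⁻¹ • V (c + w)) :
    ∀ y, V y = 0 := by
  -- first: `V (c + w) = 0` for every `w`
  have hw : ∀ w, V (c + w) = 0 := by
    intro w
    by_contra hne
    have hpos : 0 < ‖V (c + w)‖ := norm_pos_iff.2 hne
    -- continuity at `λ = 0` of `λ ↦ V (c + λ • w)` bounds it near `0`
    have hcont0 : ContinuousAt (fun lam : ℝ => V (c + lam • w)) 0 :=
      (hV.comp (continuous_const.add (continuous_id.smul continuous_const))).continuousAt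
    have hbd : ∀ᶠ lam : ℝ in 𝓝 0, ‖V (c + lam • w)‖ < ‖V c‖ + 1 := by
      have h1 : ∀ᶠ lam : ℝ in 𝓝 0, dist (V (c + lam • w)) (V (c + (0 : ℝ) • w)) < 1 :=
        (Metric.tendsto_nhds.1 hcont0) 1 one_pos
      filter_upwards [h1] with lam hlam
      rw [zero_smul, add_zero, dist_eq_norm] at hlam
      calc ‖V (c + lam • w)‖ = ‖(V (c + lam • w) - V c) + V c‖ := by rw [sub_add_cancel]
        _ ≤ ‖V (c + lam • w) - V c‖ + ‖V c‖ := norm_add_le _ _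
        _ < ‖V c‖ + 1 := by linarith
    -- along `λ = 1/(n+1)` the homogeneity makes the norm `(n+1) ‖V (c + w)‖ → ∞`
    have hseq : Tendsto (fun n : ℕ => (1 : ℝ) / ((n : ℝ) + 1)) atTop (𝓝 0) :=
      tendsto_one_div_add_atTop_nhds_zero_nat
    have hev := hseq.eventually hbd
    obtain ⟨N, hN⟩ := exists_nat_gt ((‖V c‖ + 1) / ‖V (c + w)‖)
    obtain ⟨n, hn, hnN⟩ : ∃ n : ℕ, ‖V (c + ((1 : ℝ) / ((n : ℝ) + 1)) • w)‖ < ‖V c‖ + 1 ∧ N ≤ n := by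
      obtain ⟨n, hn⟩ := (hev.and (eventually_ge_atTop N)).exists
      exact ⟨n, hn.1, hn.2⟩
    have hn1 : (0 : ℝ) < (n : ℝ) + 1 := by positivity
    rw [hhom _ (by positivity) w, norm_smul, norm_inv, Real.norm_of_nonneg (by positivity), one_div, inv_inv] at hn
    have hN' : (‖V c‖ + 1) < ((n : ℝ) + 1) * ‖V (c + w)‖ := by
      have h1 : (‖V c‖ + 1) / ‖V (c + w)‖ < (n : ℝ) + 1 := by
        have : (N : ℝ) ≤ n := by exact_mod_cast hnN
        linarith
      rwa [div_lt_iff₀ hpos] at h1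
    linarith
  intro y
  have := hw (y - c)
  rwa [add_sub_cancel] at this

/-- **A profile of the Type-I class with ONE slice `(−1)`-homogeneous about some centre vanishes identically**
(`eq_zero_of_homogeneous_negOne` on the continuous slice; then every slice vanishes, `eq_of_slice_eq` against the
zero field being unnecessary: a zero slice has vorticity aligned with any direction, stratum `eq_zero_of_aligned`). -/
theorem eq_zero_of_homogeneous_slice (hrate : HasTypeITimeDecay C v)
    (hcont : ContinuousOn (uncurry v) (Iio (0 : ℝ) ×ˢ univ))
    (hmild : ∀ s t : ℝ, s < t → t < 0 → ∀ x,
      v t x = UnboundedOperators.heatExtension (v s) (t - s) x - oseenDuhamel 1 s v v t x)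
    (hdiv : ∀ t < 0, VectorCalculus.IsDivFree (v t)) {s : ℝ} (hs : s < 0) (c : EuclideanSpace ℝ (Fin 3))
    (hhom : ∀ (lam : ℝ), 0 < lam → ∀ w : EuclideanSpace ℝ (Fin 3), v s (c + lam • w) = lam⁻¹ • v s (c + w)) :
    ∀ t < 0, ∀ x, v t x = 0 := by
  have hzero : ∀ y, v s y = 0 := eq_zero_of_homogeneous_negOne (continuous_slice hcont hs) c hhom
  have hvs : v s = 0 := funext fun y => by rw [hzero y]; rfl
  have he : (EuclideanSpace.single 0 1 : EuclideanSpace ℝ (Fin 3)) ≠ 0 := by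
    intro h0
    have := congrArg (fun w : EuclideanSpace ℝ (Fin 3) => w 0) h0
    simp at this
  refine eq_zero_of_aligned hrate hcont hmild hdiv he hs fun y => ?_
  rw [hvs, curl_zero]
  simp [cross, crossProduct]

/-! ### Discrete screw / glide symmetry of ONE slice (appended) -/

/-- Iterating a rigid motion `g y = L y + ℓ` whose translation part is fixed by its linear part (`L ℓ = ℓ`):
`g^[k] y = L^[k] y + k ℓ`, and a `g`-equivariant slice is `g^[k]`-equivariant:
`V (L^[k] y + k ℓ) = L^[k] (V y)`. -/
theorem iterate_rigidMotion_equivariant {V : EuclideanSpace ℝ (Fin 3) → EuclideanSpace ℝ (Fin 3)}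
    (L : EuclideanSpace ℝ (Fin 3) ≃ₗᵢ[ℝ] EuclideanSpace ℝ (Fin 3)) {ℓ : EuclideanSpace ℝ (Fin 3)} (hfix : L ℓ = ℓ)
    (hsym : ∀ y, V (L y + ℓ) = L (V y)) :
    ∀ (k : ℕ) (y : EuclideanSpace ℝ (Fin 3)), V ((⇑L)^[k] y + (k : ℝ) • ℓ) = (⇑L)^[k] (V y) := by
  intro k
  induction k with
  | zero => intro y; simp
  | succ k ih =>
    intro y
    have e : (⇑L)^[k + 1] y + ((k + 1 : ℕ) : ℝ) • ℓ = L ((⇑L)^[k] y + (k : ℝ) • ℓ) + ℓ := by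
      rw [Function.iterate_succ_apply', Nat.cast_succ, add_smul, one_smul, map_add, L.map_smul, hfix, add_assoc]
    rw [e, hsym, ih, Function.iterate_succ_apply']

/-- **ONE slice with a DISCRETE SCREW or GLIDE symmetry of finite rotational order ⇒ trivial.** If one slice
`s < 0` of a profile of the Type-I class is equivariant under a rigid motion `y ↦ L y + ℓ` — `L` a linear isometry
with `L^[n] = id` for some `n ≥ 1`, translation part `ℓ ≠ 0` fixed by `L` — i.e. `v(s, L y + ℓ) = L v(s, y)` for all
`y` (a screw motion with RATIONAL angle `2πp/n` and translation along its axis; a glide reflection, `n = 2`; any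
crystallographic operation with nonzero intrinsic translation), then `v ≡ 0`: the `n`-th iterate is the pure
translation by `n ℓ ≠ 0` (`iterate_rigidMotion_equivariant`), so the slice is spatially periodic and
`eq_zero_of_periodic_slice` applies.  (Contrast the tree's `eq_zero_of_twistedPeriodic`, whose twist acts on the
VALUES only and on every slice.) -/
theorem eq_zero_of_discreteScrew_slice (hrate : HasTypeITimeDecay C v)
    (hcont : ContinuousOn (uncurry v) (Iio (0 : ℝ) ×ˢ univ))
    (hmild : ∀ s t : ℝ, s < t → t < 0 → ∀ x,
      v t x = UnboundedOperators.heatExtension (v s) (t - s) x - oseenDuhamel 1 s v v t x)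
    (hdiv : ∀ t < 0, VectorCalculus.IsDivFree (v t)) {s : ℝ} (hs : s < 0)
    (L : EuclideanSpace ℝ (Fin 3) ≃ₗᵢ[ℝ] EuclideanSpace ℝ (Fin 3)) {ℓ : EuclideanSpace ℝ (Fin 3)} (hℓ : ℓ ≠ 0)
    (hfix : L ℓ = ℓ) {n : ℕ} (hn : 0 < n) (hLn : ∀ z, (⇑L)^[n] z = z)
    (hsym : ∀ y, v s (L y + ℓ) = L (v s y)) : ∀ t < 0, ∀ x, v t x = 0 := by
  have hnℓ : ((n : ℝ) • ℓ : EuclideanSpace ℝ (Fin 3)) ≠ 0 := smul_ne_zero (Nat.cast_ne_zero.2 hn.ne') hℓ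
  refine eq_zero_of_periodic_slice hrate hcont hmild hdiv hs hnℓ fun y => ?_
  have h := iterate_rigidMotion_equivariant L hfix hsym n y
  rwa [hLn, hLn] at h

/-- ONE slice with a discrete screw / glide symmetry of finite rotational order ⇒ not backward-singular. -/
theorem nonflatLiouville_of_discreteScrew_slice (hrate : HasTypeITimeDecay C v)
    (hcont : ContinuousOn (uncurry v) (Iio (0 : ℝ) ×ˢ univ))
    (hmild : ∀ s t : ℝ, s < t → t < 0 → ∀ x,
      v t x = UnboundedOperators.heatExtension (v s) (t - s) x - oseenDuhamel 1 s v v t x)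
    (hdiv : ∀ t < 0, VectorCalculus.IsDivFree (v t)) {s : ℝ} (hs : s < 0)
    (L : EuclideanSpace ℝ (Fin 3) ≃ₗᵢ[ℝ] EuclideanSpace ℝ (Fin 3)) {ℓ : EuclideanSpace ℝ (Fin 3)} (hℓ : ℓ ≠ 0)
    (hfix : L ℓ = ℓ) {n : ℕ} (hn : 0 < n) (hLn : ∀ z, (⇑L)^[n] z = z)
    (hsym : ∀ y, v s (L y + ℓ) = L (v s y)) : ¬ IsBackwardSingularPoint v 0 :=
  not_backwardSingular_of_zero (eq_zero_of_discreteScrew_slice hrate hcont hmild hdiv hs L hℓ hfix hn hLn hsym)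

end Summit.NavierStokesRegularity.NavierStokesRegularity.Theorems.LocalHelicityTubeDoorFrobeniusProfileRigidityHelicalSlice

end
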